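import Summits.RiemannHypothesis.RiemannHypothesis.Theorems.HandoffSemilocalParitySplit
import Summits.RiemannHypothesis.RiemannHypothesis.Theorems.HandoffSemilocalContinuity
import HarnessLib

/-!
# HANDOFF — at every semi-local wall (at least) ONE SECTOR carries it (cell rh-explicit, TRACK «HANDOFF», seat theory-2)

HONEST FRAMING. Nothing here bears on the truth of RH. HANDOFF-STATEMENT §H.2 records «odd carries the wall, even carries the margin» as DATA
(every A4 wall cell is bound by its free-odd section). The typed half of that sentence: combining the PARITY SPLIT of every semi-local form
(`HandoffSemilocalParitySplit.semilocalGroundEnergy_eq_min_even_odd`, this seat) with theory-1's «the bottom vanishes EXACTLY at the wall»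
(`HandoffSemilocalEnergy.semilocalGroundEnergy_threshold_eq_zero`, file XI-b), for every finite set of primes `S`:

* at the wall `a*(S)` both sector bottoms are `≥ 0` and (at least) one of them is `= 0` (`exists_sectorEnergy_eq_zero_at_threshold`);
* strictly beyond the wall (at least) one sector bottom is `< 0` (`exists_sectorEnergy_neg_of_threshold_lt`);
* below the wall both are `≥ 0`.

WHICH sector it is (odd, in every certified cell of the A4 table) is DATA and is not claimed here.

References: M. Suzuki, arXiv:2606.09096, §4.5 eq. (4.10) (arXiv p. 18) (`Suzuki2026`); H. Yoshida, Adv. Stud. Pure Math. 21 (1992) Prop. 6 (p. 320)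
(`Yoshida1992HermitianForms`); A. Connes, C. Consani, Enseign. Math. 69 (2023) 93–148 = arXiv:2106.01715, §2.1.3 (`ConnesConsani2023`).
-/

set_option linter.dupNamespace false  -- the mandated namespace repeats `RiemannHypothesis`

noncomputable section

open Set Literature.NumberTheory.LFunctions
open Summit.RiemannHypothesis.RiemannHypothesis.Theorems
open Summit.RiemannHypothesis.RiemannHypothesis.Theorems.HandoffSemilocalEnergy
open Summit.RiemannHypothesis.RiemannHypothesis.Theorems.HandoffSemilocalParitySplit
open Summit.RiemannHypothesis.RiemannHypothesis.Theorems.MotivicDoor.SemilocalThreshold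

namespace Summit.RiemannHypothesis.RiemannHypothesis.Theorems.HandoffWallSector

variable {S : Finset ℕ} {a : ℝ}

/-- **At the wall the smaller sector bottom is exactly `0`**: `min(λ_ev(S; a*(S)), λ_od(S; a*(S))) = 0`. [cite: Yoshida1992HermitianForms, Prop. 6 (p. 320), primes restricted to S; this track] -/
theorem min_sectorEnergy_threshold_eq_zero (S : Finset ℕ) :
    min (semilocalGroundEnergy S (fun g ↦ ∀ t, g (-t) = g t) (weilSemilocalThreshold S))
      (semilocalGroundEnergy S (fun g ↦ ∀ t, g (-t) = -g t) (weilSemilocalThreshold S)) = 0 := by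
  rw [← semilocalGroundEnergy_eq_min_even_odd, semilocalGroundEnergy_threshold_eq_zero]

/-- At the wall BOTH sector bottoms are `≥ 0`. [folklore] -/
theorem sectorEnergies_nonneg_at_threshold (S : Finset ℕ) :
    0 ≤ semilocalGroundEnergy S (fun g ↦ ∀ t, g (-t) = g t) (weilSemilocalThreshold S) ∧
      0 ≤ semilocalGroundEnergy S (fun g ↦ ∀ t, g (-t) = -g t) (weilSemilocalThreshold S) := by
  have h := min_sectorEnergy_threshold_eq_zero S
  exact ⟨le_trans h.ge (min_le_left _ _), le_trans h.ge (min_le_right _ _)⟩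

/-- **(At least) ONE SECTOR CARRIES THE WALL**: `λ_ev(S; a*(S)) = 0 ∨ λ_od(S; a*(S)) = 0` for every finite `S`. (Which one is DATA:
«odd», HANDOFF-STATEMENT §H.2.) [cite: Suzuki2026, §4.5 eq. (4.10) (arXiv p. 18), primes restricted to S; this track] -/
theorem exists_sectorEnergy_eq_zero_at_threshold (S : Finset ℕ) :
    semilocalGroundEnergy S (fun g ↦ ∀ t, g (-t) = g t) (weilSemilocalThreshold S) = 0 ∨
      semilocalGroundEnergy S (fun g ↦ ∀ t, g (-t) = -g t) (weilSemilocalThreshold S) = 0 := by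
  have h := min_sectorEnergy_threshold_eq_zero S
  rcases min_choice (semilocalGroundEnergy S (fun g ↦ ∀ t, g (-t) = g t) (weilSemilocalThreshold S))
    (semilocalGroundEnergy S (fun g ↦ ∀ t, g (-t) = -g t) (weilSemilocalThreshold S)) with hm | hm
  · exact Or.inl (hm ▸ h)
  · exact Or.inr (hm ▸ h)

/-- **Strictly beyond the wall (at least) one sector bottom is negative**: `a*(S) < a ⟹ λ_ev(S; a) < 0 ∨ λ_od(S; a) < 0`. [cite: Yoshida1992HermitianForms, Prop. 6 (p. 320), primes restricted to S] -/
theorem exists_sectorEnergy_neg_of_threshold_lt (h : weilSemilocalThreshold S < a) :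
    semilocalGroundEnergy S (fun g ↦ ∀ t, g (-t) = g t) a < 0 ∨ semilocalGroundEnergy S (fun g ↦ ∀ t, g (-t) = -g t) a < 0 := by
  have htop : semilocalGroundEnergy S (fun _ ↦ True) a < 0 := by
    by_contra hge
    exact absurd (semilocalGroundEnergy_top_nonneg_iff_le_threshold.1 (not_lt.1 hge)) (not_le.2 h)
  rw [semilocalGroundEnergy_eq_min_even_odd] at htop
  exact min_lt_iff.1 htop

/-- Below (or at) the wall BOTH sector bottoms are `≥ 0`: `a ≤ a*(S) ⟹ 0 ≤ λ_ev(S; a) ∧ 0 ≤ λ_od(S; a)`. [cite: Yoshida1992HermitianForms, Prop. 6 (p. 320), primes restricted to S] -/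
theorem sectorEnergies_nonneg_of_le_threshold (h : a ≤ weilSemilocalThreshold S) :
    0 ≤ semilocalGroundEnergy S (fun g ↦ ∀ t, g (-t) = g t) a ∧ 0 ≤ semilocalGroundEnergy S (fun g ↦ ∀ t, g (-t) = -g t) a :=
  (semilocalGroundEnergy_top_nonneg_iff_sectors S a).1 (semilocalGroundEnergy_top_nonneg_iff_le_threshold.2 h)

/-- Dictionary: **`a*(S) < a ↔ (λ_ev(S; a) < 0 ∨ λ_od(S; a) < 0)`** — the wall is the first bandwidth at which SOME sector turns negative. [cite: Yoshida1992HermitianForms, Prop. 6 (p. 320), primes restricted to S] -/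
theorem threshold_lt_iff_exists_sectorEnergy_neg (S : Finset ℕ) (a : ℝ) :
    weilSemilocalThreshold S < a ↔
      semilocalGroundEnergy S (fun g ↦ ∀ t, g (-t) = g t) a < 0 ∨ semilocalGroundEnergy S (fun g ↦ ∀ t, g (-t) = -g t) a < 0 := by
  refine ⟨exists_sectorEnergy_neg_of_threshold_lt, fun h ↦ ?_⟩
  rcases h with h | h
  · exact weilSemilocalThreshold_lt_of_even_neg h
  · exact weilSemilocalThreshold_lt_of_odd_neg h

end Summit.RiemannHypothesis.RiemannHypothesis.Theorems.HandoffWallSector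

end
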